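import Literature.MathematicalPhysics.QuantumFieldTheory.Dimock2011to13.MayerExpansion
import Literature.Probability.LatticeModels.HardCoreUrsell

/-!
# Dimock, *The renormalization group according to Balaban* I, Appendix B, proof of THEOREM `\label{cluster}`, STEP 3 —
# THE URSELL COEFFICIENTS AS PRINTED: *"ρ^T(Y_1,…,Y_n) = Σ_G Π_{{i,j}∈G}(ζ(Y_i,Y_j) − 1) where the sum is now over
# connected graphs G on (1,…,n)"* EQUALS the Möbius-defined hard-core Ursell coefficient of the tree (the unique solution
# of (sunset)) — PROVED for every finite symmetric graph

**Citation header (reproduction of PUBLISHED work; template of the Bałaban lattice Yang–Mills cell).**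
J. Dimock, *The renormalization group according to Balaban I. Small fields*, Rev. Math. Phys. **25** (2013) 1330010
(= arXiv:1108.1335v2) [Dimock2013], Appendix B "cluster expansion", proof of THEOREM `\label{cluster}` (#27), step 3 TeX
L3316–3354: the hard core `ζ` (L3322–3324), the `+1 − 1` trick and the graphs `G` on `(1,…,n)` (L3331–3340), (sunset)
(L3341–3346), the Ursell coefficients `ρ^T` (L3347–3354).  TeX line numbers refer to the arXiv source held by the cell
(`inputs/files/dimock/src/1108.1335/1108.1335.tex`); every quotation below was read there this session.  Dimock's papers
are published and refereed and are the cell's TEMPLATE, not manuscripts under audit; no quantity of the Bałaban series is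
touched.

**What the paper prints (verbatim, L3331–3354).**  *"Next write Π_{{i,j}} ζ(Y_i,Y_j) = Π_{{i,j}}[1 + (ζ(Y_i,Y_j) − 1)] = Σ_G
Π_{{i,j}∈G}(ζ(Y_i,Y_j) − 1) Here in the second step we expand out the product and identify the sum with a sum over
collections of pairs {i,j} from (1,…n), that is with graphs G on (1,…,n). Each graph determines a partition {I_1,…,I_K}
of (1,…,n) and we group together terms which give the same partition. Then we have Π_{{i,j}} ζ(Y_i,Y_j) = Σ_{K=1}^n
Σ_{{I_1,…,I_K} ∈ π_{n,K}} Π_{k=1}^K ρ^T(Y_{I_k}) where π_{n,K} is the partitions of (1,…,n) into K subsets. We have defined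
ρ^T(Y) = 1 and for n ≥ 2 ρ^T(Y_1,…,Y_n) = Σ_G Π_{{i,j}∈G}(ζ(Y_i,Y_j) − 1) where the sum is now over connected graphs G on
(1,…,n). We do have ρ^T(Y_1,…,Y_n) = 0 if the Y_j can be divided into disjoint sets."*

**What is reproduced here (kernel-checked, zero `sorry`).**  For any finite vertex set `V` and symmetric relation `H`
(Dimock: the indices `(1,…,n)` with `{i,j} ↦ Y_i ∩ Y_j ≠ ∅`), on top of `Literature.Probability.LatticeModels.HardCoreUrsell`
(`hcUrsell H V`, DEFINED by Möbius inversion so that `Σ_{π} Π_{P∈π} u(P) = 𝟙[V spans no edge]` — that identity IS (sunset) —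
whose header states the connected-graph formula WITHOUT proof: *"for the overlap graph of a configuration this is the Ursell
function Σ_{G ⊆ H[V] connected, spanning} (−1)^{#E(G)} of (5.5) (both are determined by the identity, by induction on #V)"*)
and this lineage's `…Dimock2011to13.MayerExpansion` §1 (chains `Linked`, components `comp`∕`components`, `IsConnColl`):
* §1 chains under a change of relation (`Linked.imp`) and confinement (`Linked.mem_of_closed`);
* §2 `edges H V` (unordered pairs `{u,w}` of distinct `H`-related vertices, as `Sym2`), `Adj G` (adjacency in an edge set),
  **`connSets H P`** (edge sets `G ⊆ edges H P` with `(P, G)` connected and spanning), **`connSum H P := Σ_{G ∈ connSets}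
  (−1)^{|G|}`**; `mk_mem_edges`, `exists_of_mem_edges`, `edges_mono`, `edges_eq_empty_iff` (no edges ⟺ `IsCompatible`);
* §3 the vertex components of an edge set form a set partition (`components_mem_setPartitions`), the restriction of `G` to a
  component is connected spanning there (`restrict_mem_connSets`), the restrictions exhaust `G` (`biUnion_restrict`);
* §4 gluing connected spanning edge sets on the blocks of a set partition: the components of the glued graph are the blocks
  (`components_biUnion_eq`), restriction recovers the block sets (`restrict_biUnion_eq`), block sets are disjoint;
* §5 **`sum_setPartitions_prod_connSum`** — (sunset) FOR THE CONNECTED-GRAPH SUMS: `Σ_{π ∈ setPartitions V} Π_{P∈π} connSum H P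
  = 𝟙[V spans no edge of H]`, by the `+1 − 1` trick `Σ_{G ⊆ edges}(−1)^{|G|} = 𝟙[edges = ∅]` (`Finset.sum_powerset_neg_one_pow_card`)
  with the edge sets fibred over their component partitions (`Finset.sum_fiberwise_of_maps_to`) and each fibre resummed by
  the gluing bijection (`sum_pi_eq_sum_fiber`, `Finset.sum_nbij'`; `prod_connSum_eq` via `Finset.prod_sum`) — exactly the
  printed *"Each graph determines a partition … we group together terms which give the same partition"*;
* §6 **`hcUrsell_eq_connSum`**: `hcUrsell H V = connSum H V` for symmetric `H`, nonempty `V` (both solve (sunset); strong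
  induction on `V` splitting off the one-block partition);
* §7 the print's indexing: `pairs I` (all pairs), `zetaSubOne H I e ∈ {0, −1}` (`ζ − 1`), **`connSum_eq_sum_graphs`** (`connSum
  = Σ_{G connected graph on I} Π_{e∈G}(ζ_e − 1)` — graphs not inside `H` contribute `0`), **`hcUrsell_eq_sum_graphs`**, and
  Dimock's instance **`hcUrsell_overlap_eq_sum_graphs`** for a tuple `Y : ι → Finset C` with `H i j := Y_i ∩ Y_j ≠ ∅` — by
  `rfl` this `H` is `UrsellTreeGraphBound.overlapGraph Y` and `hcUrsell H I` is `UrsellTreeGraphBound.rhoT Y I` (that sibling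
  leaf is not imported; the two leaves are independent).

**Readings (declared).**  (i) Graphs on a vertex set are finite sets of unordered pairs of DISTINCT vertices (`Sym2`, no
loops, no multiplicities), connectedness = every two vertices of `P` joined by a chain of `G`-edges inside `P` with `P`
nonempty (`MayerExpansion.IsConnColl`); the print's *"ρ^T(Y) = 1"* (n = 1) is the empty graph on one vertex.  (ii) `ζ − 1`
takes the values `0, −1` only (hard core), so the print's sum over all connected graphs reduces to the graphs inside the
overlap graph, where the weight is `(−1)^{|G|}` (§7 proves this reduction rather than assuming it).  (iii) `V = ∅`: the
tree's `hcUrsell H ∅ = 1` (junk, never a block) while `connSum H ∅ = 0`; the theorem is stated for nonempty `V`, as printed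
(`n ≥ 1`).

**What is NOT claimed.**  Anything beyond the identification: the tree-graph inequality (sibling leaf `UrsellTreeGraphBound`),
the exponential formula (midday)–(midday2), convergence; anything of B1–B16 (TEMPLATE.md §4.1 row «D1 §4.6» ↔ B12∕B13 —
grade there; untouched).  NOT summit progress; NOT a statement about any Bałaban paper; NOT continuum; NOT Clay.  NEW leaf;
imports `…Dimock2011to13.MayerExpansion` (this lineage, v1.1 p206512) and `Literature.Probability.LatticeModels.HardCoreUrsell`;
no Summits import, no cycle; sub-namespace `…Dimock2011to13.UrsellConnectedGraphSum`; modifies nothing.  Unit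
`b2b-balaban-template` gen 32 (journal CLAIM D1-URSELL-GRAPH-SUM-KERNEL); cell records TEMPLATE.md §4.1 row «D1 §4.6», §15.2;
GAPS C-tmpl32-8.
-/

noncomputable section

open Finset
open Literature.MathematicalPhysics.QuantumFieldTheory.Dimock2011to13.MayerExpansion (Linked comp components IsConnColl
  mem_comp comp_subset mem_comp_self comp_eq_of_mem mem_components comp_mem_components subset_of_mem_components
  comp_disjoint_or_eq)
open Literature.Probability.LatticeModels (IsSetPartition setPartitions mem_setPartitions blockOf hcUrsell hcUrsell_eq
  edgeFreeInd IsCompatible isSetPartition_singleton)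

namespace Literature.MathematicalPhysics.QuantumFieldTheory.Dimock2011to13.UrsellConnectedGraphSum

variable {α : Type*} [DecidableEq α]

/-! ## §1 Chains: changing the relation -/

omit [DecidableEq α] in
/-- a chain for one relation is a chain for any relation containing it on the collection. [cite: Dimock2013, App. B Theorem cluster, proof step 3 (arXiv:1108.1335v2 TeX L3316–3354)] -/
theorem Linked.imp {ov ov' : α → α → Prop} {S : Finset α} (h : ∀ a ∈ S, ∀ b ∈ S, ov a b → ov' a b) {X Y : α}
    (hXY : Linked ov S X Y) : Linked ov' S X Y := by
  induction hXY with
  | refl => exact Relation.ReflTransGen.refl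
  | tail _ hbc ih => exact Relation.ReflTransGen.tail ih ⟨hbc.1, hbc.2.1, h _ hbc.1 _ hbc.2.1 hbc.2.2⟩

omit [DecidableEq α] in
/-- a chain all of whose steps stay in a set `P ∋ X` ends in `P`. [cite: Dimock2013, App. B Theorem cluster, proof step 3 (arXiv:1108.1335v2 TeX L3316–3354)] -/
theorem Linked.mem_of_closed {ov : α → α → Prop} {S P : Finset α} (hP : ∀ a ∈ P, ∀ b ∈ S, ov a b → b ∈ P) {X Y : α}
    (hX : X ∈ P) (hXY : Linked ov S X Y) : Y ∈ P := by
  induction hXY with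
  | refl => exact hX
  | tail _ hbc ih => exact hP _ ih _ hbc.2.1 hbc.2.2

/-! ## §2 Edges of `H` on a vertex set; adjacency in an edge set; connected spanning edge sets -/

variable (H : α → α → Prop) [DecidableRel H]

/-- the EDGES of the graph `H` on the vertex set `V`: unordered pairs `{u, w}` of distinct vertices of `V` with `H u w`. [cite: Dimock2013, App. B Theorem cluster, proof step 3 (arXiv:1108.1335v2 TeX L3316–3354)] -/
def edges (V : Finset α) : Finset (Sym2 α) :=
  ((V ×ˢ V).filter fun p => p.1 ≠ p.2 ∧ H p.1 p.2).image fun p => s(p.1, p.2)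

variable {H}

/-- membership of a pair in `edges` (symmetric `H`). [cite: Dimock2013, App. B Theorem cluster, proof step 3 (arXiv:1108.1335v2 TeX L3316–3354)] -/
theorem mk_mem_edges (hsymm : ∀ a b, H a b → H b a) {V : Finset α} {u w : α} :
    s(u, w) ∈ edges H V ↔ u ∈ V ∧ w ∈ V ∧ u ≠ w ∧ H u w := by
  simp only [edges, Finset.mem_image, Finset.mem_filter, Finset.mem_product, Prod.exists, Sym2.eq_iff]
  constructor
  · rintro ⟨a, b, ⟨⟨ha, hb⟩, hne, hH⟩, h⟩
    rcases h with ⟨rfl, rfl⟩ | ⟨rfl, rfl⟩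
    · exact ⟨ha, hb, hne, hH⟩
    · exact ⟨hb, ha, hne.symm, hsymm _ _ hH⟩
  · rintro ⟨hu, hw, hne, hH⟩
    exact ⟨u, w, ⟨⟨hu, hw⟩, hne, hH⟩, Or.inl ⟨rfl, rfl⟩⟩

/-- every edge is a pair of distinct `H`-related vertices. [cite: Dimock2013, App. B Theorem cluster, proof step 3 (arXiv:1108.1335v2 TeX L3316–3354)] -/
theorem exists_of_mem_edges {V : Finset α} {e : Sym2 α} (he : e ∈ edges H V) :
    ∃ u w, e = s(u, w) ∧ u ∈ V ∧ w ∈ V ∧ u ≠ w ∧ H u w := by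
  simp only [edges, Finset.mem_image, Finset.mem_filter, Finset.mem_product, Prod.exists] at he
  obtain ⟨a, b, ⟨⟨ha, hb⟩, hne, hH⟩, rfl⟩ := he
  exact ⟨a, b, rfl, ha, hb, hne, hH⟩

/-- the endpoints of an edge are vertices. [cite: Dimock2013, App. B Theorem cluster, proof step 3 (arXiv:1108.1335v2 TeX L3316–3354)] -/
theorem mem_of_mem_edges {V : Finset α} {e : Sym2 α} (he : e ∈ edges H V) {a : α} (ha : a ∈ e) : a ∈ V := by
  obtain ⟨u, w, rfl, hu, hw, -, -⟩ := exists_of_mem_edges he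
  rcases Sym2.mem_iff.1 ha with rfl | rfl
  · exact hu
  · exact hw

/-- `edges` is monotone in the vertex set. [cite: Dimock2013, App. B Theorem cluster, proof step 3 (arXiv:1108.1335v2 TeX L3316–3354)] -/
theorem edges_mono {P V : Finset α} (hPV : P ⊆ V) : edges H P ⊆ edges H V := by
  intro e he
  simp only [edges, Finset.mem_image, Finset.mem_filter, Finset.mem_product, Prod.exists] at he ⊢
  obtain ⟨a, b, ⟨⟨ha, hb⟩, hne, hH⟩, rfl⟩ := he
  exact ⟨a, b, ⟨⟨hPV ha, hPV hb⟩, hne, hH⟩, rfl⟩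

/-- no edges iff no two distinct vertices are related (`IsCompatible`). [cite: Dimock2013, App. B Theorem cluster, proof step 3 (arXiv:1108.1335v2 TeX L3316–3354)] -/
theorem edges_eq_empty_iff (hsymm : ∀ a b, H a b → H b a) {V : Finset α} : edges H V = ∅ ↔ IsCompatible H V := by
  rw [Literature.Probability.LatticeModels.isCompatible_iff', Finset.eq_empty_iff_forall_notMem]
  constructor
  · intro h u hu w hw hne hH
    exact h _ ((mk_mem_edges hsymm).2 ⟨hu, hw, hne, hH⟩)
  · intro h e he
    obtain ⟨u, w, rfl, hu, hw, hne, hH⟩ := exists_of_mem_edges he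
    exact h u hu w hw hne hH

/-- ADJACENCY in an edge set `G`. [cite: Dimock2013, App. B Theorem cluster, proof step 3 (arXiv:1108.1335v2 TeX L3316–3354)] -/
def Adj (G : Finset (Sym2 α)) : α → α → Prop := fun u w => s(u, w) ∈ G

omit [DecidableEq α] in
/-- adjacency in an edge set is symmetric. [cite: Dimock2013, App. B Theorem cluster, proof step 3 (arXiv:1108.1335v2 TeX L3316–3354)] -/
theorem adj_symm (G : Finset (Sym2 α)) : ∀ u w, Adj G u w → Adj G w u := by
  intro u w h; simpa [Adj, Sym2.eq_swap] using h

omit [DecidableEq α] in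
/-- adjacency is monotone in the edge set. [cite: Dimock2013, App. B Theorem cluster, proof step 3 (arXiv:1108.1335v2 TeX L3316–3354)] -/
theorem adj_mono {G G' : Finset (Sym2 α)} (h : G ⊆ G') {u w : α} (huw : Adj G u w) : Adj G' u w := h huw

variable (H)

/-- the CONNECTED SPANNING EDGE SETS on `P` inside `H`: edge sets `G ⊆ edges H P` such that `P` is nonempty and any two of
its vertices are joined by a chain of `G`-edges (*"connected graphs G on (1,…,n)"*). [cite: Dimock2013, App. B Theorem cluster, proof step 3 (arXiv:1108.1335v2 TeX L3316–3354)] -/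
def connSets (P : Finset α) : Finset (Finset (Sym2 α)) := by
  classical exact (edges H P).powerset.filter fun G => IsConnColl (Adj G) P

/-- **Dimock's ∕ Friedli–Velenik's CONNECTED-GRAPH SUM** `Σ_G Π_{{i,j}∈G}(ζ(Y_i,Y_j) − 1)` for the hard core `ζ − 1 = −𝟙_H`:
`Σ_{G connected spanning on P, G ⊆ H} (−1)^{|G|}`. [cite: Dimock2013, App. B Theorem cluster, proof step 3 (arXiv:1108.1335v2 TeX L3316–3354)] -/
def connSum (P : Finset α) : ℤ := ∑ G ∈ connSets H P, (-1) ^ G.card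

variable {H}

/-- membership in `connSets`. [cite: Dimock2013, App. B Theorem cluster, proof step 3 (arXiv:1108.1335v2 TeX L3316–3354)] -/
theorem mem_connSets {P : Finset α} {G : Finset (Sym2 α)} : G ∈ connSets H P ↔ G ⊆ edges H P ∧ IsConnColl (Adj G) P := by
  classical
  simp [connSets]

/-! ## §3 The vertex components of an edge set and the restriction of an edge set to a block -/

/-- the edges of `G` with both endpoints in `P`. [cite: Dimock2013, App. B Theorem cluster, proof step 3 (arXiv:1108.1335v2 TeX L3316–3354)] -/
def restrict (G : Finset (Sym2 α)) (P : Finset α) : Finset (Sym2 α) := by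
  classical exact G.filter fun e => ∀ a ∈ e, a ∈ P

omit [DecidableEq α] in
/-- membership in `restrict`. [cite: Dimock2013, App. B Theorem cluster, proof step 3 (arXiv:1108.1335v2 TeX L3316–3354)] -/
theorem mem_restrict {G : Finset (Sym2 α)} {P : Finset α} {e : Sym2 α} : e ∈ restrict G P ↔ e ∈ G ∧ ∀ a ∈ e, a ∈ P := by
  classical
  simp [restrict]

/-- the vertex components of `(V, G)` form a set partition of `V`. [cite: Dimock2013, App. B Theorem cluster, proof step 3 (arXiv:1108.1335v2 TeX L3316–3354)] -/
theorem components_mem_setPartitions (G : Finset (Sym2 α)) (V : Finset α) : components (Adj G) V ∈ setPartitions V := by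
  rw [mem_setPartitions]
  refine ⟨fun P hP => subset_of_mem_components hP, fun h => ?_, fun v hv => ⟨_, comp_mem_components hv, mem_comp_self hv⟩,
    fun P hP Q hQ v hvP hvQ => ?_⟩
  · obtain ⟨X, hX, hXe⟩ := mem_components.1 h
    exact Finset.notMem_empty X (hXe ▸ mem_comp_self hX)
  · obtain ⟨X, -, rfl⟩ := mem_components.1 hP
    obtain ⟨X', -, rfl⟩ := mem_components.1 hQ
    rcases comp_disjoint_or_eq (adj_symm G) V X X' with h | h
    · exact absurd hvQ (Finset.disjoint_left.1 h hvP)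
    · exact h

/-- an edge of `G ⊆ edges H V` lies inside the component of either endpoint. [cite: Dimock2013, App. B Theorem cluster, proof step 3 (arXiv:1108.1335v2 TeX L3316–3354)] -/
theorem mem_restrict_comp {G : Finset (Sym2 α)} {V : Finset α} (hG : G ⊆ edges H V) {u w : α} (he : s(u, w) ∈ G) :
    s(u, w) ∈ restrict G (comp (Adj G) V u) := by
  obtain ⟨hu, hw, -, -⟩ : u ∈ V ∧ w ∈ V ∧ True ∧ True := by
    obtain ⟨a, b, hab, ha, hb, -, -⟩ := exists_of_mem_edges (hG he)
    rcases Sym2.eq_iff.1 hab with ⟨rfl, rfl⟩ | ⟨rfl, rfl⟩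
    · exact ⟨ha, hb, trivial, trivial⟩
    · exact ⟨hb, ha, trivial, trivial⟩
  refine mem_restrict.2 ⟨he, fun a ha => ?_⟩
  rcases Sym2.mem_iff.1 ha with rfl | rfl
  · exact mem_comp_self hu
  · exact mem_comp.2 ⟨hw, Relation.ReflTransGen.single ⟨hu, hw, he⟩⟩

/-- the restriction of `G ⊆ edges H V` to one of its components is a connected spanning edge set on that component. [cite: Dimock2013, App. B Theorem cluster, proof step 3 (arXiv:1108.1335v2 TeX L3316–3354)] -/
theorem restrict_mem_connSets {G : Finset (Sym2 α)} {V : Finset α} (hG : G ⊆ edges H V) {P : Finset α}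
    (hP : P ∈ components (Adj G) V) : restrict G P ∈ connSets H P := by
  obtain ⟨X, hX, rfl⟩ := mem_components.1 hP
  refine mem_connSets.2 ⟨fun e he => ?_, ⟨X, mem_comp_self hX⟩, fun Y hY Z hZ => ?_⟩
  · obtain ⟨heG, hin⟩ := mem_restrict.1 he
    obtain ⟨u, w, rfl, -, -, hne, hH⟩ := exists_of_mem_edges (hG heG)
    simp only [edges, Finset.mem_image, Finset.mem_filter, Finset.mem_product, Prod.exists]
    exact ⟨u, w, ⟨⟨hin u (Sym2.mem_mk_left u w), hin w (Sym2.mem_mk_right u w)⟩, hne, hH⟩, rfl⟩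
  · -- `Y`, `Z` are linked through `G` inside `V`, hence inside the component, by edges inside the component
    have hYZ : Linked (Adj G) V Y Z := ((mem_comp.1 hY).2.symm' (adj_symm G)).trans' (mem_comp.1 hZ).2
    have hYZ' : Linked (Adj G) (comp (Adj G) V Y) Y Z := hYZ.in_comp
    rw [comp_eq_of_mem (adj_symm G) hY] at hYZ'
    exact Linked.imp (fun a ha b hb hab => mem_restrict.2 ⟨hab, fun c hc => by
      rcases Sym2.mem_iff.1 hc with rfl | rfl
      · exact ha
      · exact hb⟩) hYZ'

/-- the restrictions to the components exhaust `G`. [cite: Dimock2013, App. B Theorem cluster, proof step 3 (arXiv:1108.1335v2 TeX L3316–3354)] -/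
theorem biUnion_restrict {G : Finset (Sym2 α)} {V : Finset α} (hG : G ⊆ edges H V) :
    (components (Adj G) V).biUnion (restrict G) = G := by
  ext e
  simp only [Finset.mem_biUnion]
  constructor
  · rintro ⟨P, -, he⟩; exact (mem_restrict.1 he).1
  · intro he
    obtain ⟨u, w, rfl, hu, -, -, -⟩ := exists_of_mem_edges (hG he)
    exact ⟨_, comp_mem_components hu, mem_restrict_comp hG he⟩

/-! ## §4 Gluing connected edge sets on the blocks of a set partition -/

section Glue

variable {V : Finset α} {π : Finset (Finset α)} {f : Finset α → Finset (Sym2 α)}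

/-- the glued edge set lies in `edges H V`. [cite: Dimock2013, App. B Theorem cluster, proof step 3 (arXiv:1108.1335v2 TeX L3316–3354)] -/
theorem biUnion_subset_edges (hπ : IsSetPartition V π) (hf : ∀ P ∈ π, f P ∈ connSets H P) : π.biUnion f ⊆ edges H V := by
  intro e he
  obtain ⟨P, hP, heP⟩ := Finset.mem_biUnion.1 he
  exact edges_mono (hπ.subset hP) ((mem_connSets.1 (hf P hP)).1 heP)

/-- an edge of the glued set with an endpoint in the block `P` comes from `f P`. [cite: Dimock2013, App. B Theorem cluster, proof step 3 (arXiv:1108.1335v2 TeX L3316–3354)] -/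
theorem mem_of_mem_biUnion (hπ : IsSetPartition V π) (hf : ∀ P ∈ π, f P ∈ connSets H P) {P : Finset α} (hP : P ∈ π)
    {e : Sym2 α} (he : e ∈ π.biUnion f) {a : α} (hae : a ∈ e) (haP : a ∈ P) : e ∈ f P ∧ ∀ b ∈ e, b ∈ P := by
  obtain ⟨P', hP', heP'⟩ := Finset.mem_biUnion.1 he
  have hsub := (mem_connSets.1 (hf P' hP')).1
  have haP' : a ∈ P' := mem_of_mem_edges (hsub heP') hae
  obtain rfl : P = P' := hπ.eq_of_mem hP hP' haP haP'
  exact ⟨heP', fun b hb => mem_of_mem_edges (hsub heP') hb⟩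

/-- the component of a vertex of the block `P` in the glued graph is `P`. [cite: Dimock2013, App. B Theorem cluster, proof step 3 (arXiv:1108.1335v2 TeX L3316–3354)] -/
theorem comp_biUnion_eq (hπ : IsSetPartition V π) (hf : ∀ P ∈ π, f P ∈ connSets H P) {P : Finset α} (hP : P ∈ π)
    {x : α} (hx : x ∈ P) : comp (Adj (π.biUnion f)) V x = P := by
  ext y
  rw [mem_comp]
  constructor
  · rintro ⟨-, hxy⟩
    refine Linked.mem_of_closed (P := P) (fun a ha b _ hab => ?_) hx hxy
    exact (mem_of_mem_biUnion hπ hf hP hab (Sym2.mem_mk_left a b) ha).2 b (Sym2.mem_mk_right a b)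
  · intro hy
    obtain ⟨-, hconn⟩ := (mem_connSets.1 (hf P hP)).2
    refine ⟨hπ.subset hP hy, ?_⟩
    have h1 : Linked (Adj (f P)) P x y := hconn x hx y hy
    have h2 : Linked (Adj (π.biUnion f)) P x y :=
      Linked.imp (fun a _ b _ hab => adj_mono (Finset.subset_biUnion_of_mem f hP) hab) h1
    exact h2.mono (hπ.subset hP)

/-- the components of the glued graph are the blocks. [cite: Dimock2013, App. B Theorem cluster, proof step 3 (arXiv:1108.1335v2 TeX L3316–3354)] -/
theorem components_biUnion_eq (hπ : IsSetPartition V π) (hf : ∀ P ∈ π, f P ∈ connSets H P) :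
    components (Adj (π.biUnion f)) V = π := by
  ext T
  rw [mem_components]
  constructor
  · rintro ⟨x, hx, rfl⟩
    rw [comp_biUnion_eq hπ hf (hπ.blockOf_mem hx) (hπ.mem_blockOf hx)]
    exact hπ.blockOf_mem hx
  · intro hT
    obtain ⟨x, hx⟩ := hπ.nonempty_of_mem hT
    exact ⟨x, hπ.subset hT hx, comp_biUnion_eq hπ hf hT hx⟩

/-- restricting the glued set to a block recovers the block's edge set. [cite: Dimock2013, App. B Theorem cluster, proof step 3 (arXiv:1108.1335v2 TeX L3316–3354)] -/
theorem restrict_biUnion_eq (hπ : IsSetPartition V π) (hf : ∀ P ∈ π, f P ∈ connSets H P) {P : Finset α} (hP : P ∈ π) :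
    restrict (π.biUnion f) P = f P := by
  ext e
  rw [mem_restrict]
  constructor
  · rintro ⟨he, hin⟩
    obtain ⟨u, w, rfl, -, -, -, -⟩ := exists_of_mem_edges (biUnion_subset_edges hπ hf he)
    exact (mem_of_mem_biUnion hπ hf hP he (Sym2.mem_mk_left u w) (hin u (Sym2.mem_mk_left u w))).1
  · intro he
    exact ⟨Finset.mem_biUnion.2 ⟨P, hP, he⟩, fun b hb => mem_of_mem_edges ((mem_connSets.1 (hf P hP)).1 he) hb⟩

/-- the block edge sets are pairwise disjoint. [cite: Dimock2013, App. B Theorem cluster, proof step 3 (arXiv:1108.1335v2 TeX L3316–3354)] -/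
theorem disjoint_of_ne (hπ : IsSetPartition V π) (hf : ∀ P ∈ π, f P ∈ connSets H P) {P Q : Finset α} (hP : P ∈ π)
    (hQ : Q ∈ π) (hne : P ≠ Q) : Disjoint (f P) (f Q) := by
  rw [Finset.disjoint_left]
  intro e heP heQ
  obtain ⟨u, w, rfl, hu, -, -, -⟩ := exists_of_mem_edges ((mem_connSets.1 (hf P hP)).1 heP)
  have huQ : u ∈ Q := mem_of_mem_edges ((mem_connSets.1 (hf Q hQ)).1 heQ) (Sym2.mem_mk_left u w)
  exact hne (hπ.eq_of_mem hP hQ hu huQ)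

end Glue

/-! ## §5 The defining identity of the Ursell coefficients holds for the connected-graph sums -/

/-- extension of a dependent family of block edge sets by `∅` off `π`. [cite: Dimock2013, App. B Theorem cluster, proof step 3 (arXiv:1108.1335v2 TeX L3316–3354)] -/
def extendE (π : Finset (Finset α)) (g : (P : Finset α) → P ∈ π → Finset (Sym2 α)) : Finset α → Finset (Sym2 α) :=
  fun P => if h : P ∈ π then g P h else ∅

/-- the extension agrees with the family on `π`. [cite: Dimock2013, App. B Theorem cluster, proof step 3 (arXiv:1108.1335v2 TeX L3316–3354)] -/
theorem extendE_of_mem {π : Finset (Finset α)} (g : (P : Finset α) → P ∈ π → Finset (Sym2 α)) {P : Finset α} (hP : P ∈ π) :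
    extendE π g P = g P hP := by
  simp [extendE, hP]

/-- the extended family consists of connected spanning block edge sets. [cite: Dimock2013, App. B Theorem cluster, proof step 3 (arXiv:1108.1335v2 TeX L3316–3354)] -/
theorem extendE_spec {π : Finset (Finset α)} {g : (P : Finset α) → P ∈ π → Finset (Sym2 α)}
    (hg : g ∈ π.pi fun P => connSets H P) : ∀ P ∈ π, extendE π g P ∈ connSets H P := by
  intro P hP
  rw [extendE_of_mem g hP]
  exact Finset.mem_pi.1 hg P hP

/-- the product over the blocks of the connected sums, expanded: `Π_{P∈π} connSum P = Σ_g (−1)^{#⋃_P g P}` over the families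
of connected spanning block edge sets. [cite: Dimock2013, App. B Theorem cluster, proof step 3 (arXiv:1108.1335v2 TeX L3316–3354)] -/
theorem prod_connSum_eq {V : Finset α} {π : Finset (Finset α)} (hπ : IsSetPartition V π) :
    ∏ P ∈ π, connSum H P = ∑ g ∈ π.pi (fun P => connSets H P), (-1 : ℤ) ^ (π.biUnion (extendE π g)).card := by
  unfold connSum
  rw [Finset.prod_sum]
  refine Finset.sum_congr rfl fun g hg => ?_
  have hf := extendE_spec hg
  rw [Finset.card_biUnion (fun P hP Q hQ hne => disjoint_of_ne hπ hf hP hQ hne), ← Finset.prod_pow_eq_pow_sum,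
    ← Finset.prod_attach π (f := fun P => (-1 : ℤ) ^ (extendE π g P).card)]
  refine Finset.prod_congr rfl fun x _ => ?_
  rw [extendE_of_mem g x.2]

/-- for a fixed set partition `π` of `V`: the families of connected spanning block edge sets are in bijection (by gluing) with
the edge sets `G ⊆ edges H V` whose vertex components are exactly `π`. [cite: Dimock2013, App. B Theorem cluster, proof step 3 (arXiv:1108.1335v2 TeX L3316–3354)] -/
theorem sum_pi_eq_sum_fiber {V : Finset α} {π : Finset (Finset α)} (hπ : IsSetPartition V π) :
    ∑ g ∈ π.pi (fun P => connSets H P), (-1 : ℤ) ^ (π.biUnion (extendE π g)).card =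
      ∑ G ∈ (edges H V).powerset with components (Adj G) V = π, (-1 : ℤ) ^ G.card := by
  refine Finset.sum_nbij' (fun g => π.biUnion (extendE π g)) (fun G P _ => restrict G P) ?_ ?_ ?_ ?_ ?_
  · intro g hg
    have hf := extendE_spec (Finset.mem_coe.1 hg)
    exact Finset.mem_coe.2 (Finset.mem_filter.2 ⟨Finset.mem_powerset.2 (biUnion_subset_edges hπ hf),
      components_biUnion_eq hπ hf⟩)
  · intro G hG
    obtain ⟨hG', hcomp⟩ := Finset.mem_filter.1 (Finset.mem_coe.1 hG)
    exact Finset.mem_coe.2 (Finset.mem_pi.2 fun P hP => restrict_mem_connSets (Finset.mem_powerset.1 hG') (hcomp ▸ hP))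
  · intro g hg
    have hf := extendE_spec (Finset.mem_coe.1 hg)
    funext P hP
    rw [restrict_biUnion_eq hπ hf hP, extendE_of_mem g hP]
  · intro G hG
    obtain ⟨hG', hcomp⟩ := Finset.mem_filter.1 (Finset.mem_coe.1 hG)
    have h1 : π.biUnion (extendE π fun P _ => restrict G P) = π.biUnion (restrict G) :=
      Finset.biUnion_congr rfl fun P hP => extendE_of_mem _ hP
    simp only [h1]
    rw [← hcomp]
    exact biUnion_restrict (Finset.mem_powerset.1 hG')
  · intro g _; rfl

/-- **(sunset) for the connected-graph sums**: `Σ_{π ∈ setPartitions V} Π_{P∈π} connSum H P = 𝟙[V spans no edge of H]` — the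
`+1 − 1` trick grouped by vertex components: `Π_{{u,w} ∈ edges}(1 + (−1)) = Σ_{G ⊆ edges} (−1)^{|G|}`, the edge sets fibred
over their component partitions, each fibre resummed by gluing. [cite: Dimock2013, App. B Theorem cluster, proof step 3 (arXiv:1108.1335v2 TeX L3316–3354)] -/
theorem sum_setPartitions_prod_connSum (hsymm : ∀ a b, H a b → H b a) (V : Finset α) :
    ∑ π ∈ setPartitions V, ∏ P ∈ π, connSum H P = edgeFreeInd H V := by
  calc ∑ π ∈ setPartitions V, ∏ P ∈ π, connSum H P
      = ∑ π ∈ setPartitions V, ∑ G ∈ (edges H V).powerset with components (Adj G) V = π, (-1 : ℤ) ^ G.card :=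
        Finset.sum_congr rfl fun π hπ => by
          rw [prod_connSum_eq (mem_setPartitions.1 hπ), sum_pi_eq_sum_fiber (mem_setPartitions.1 hπ)]
    _ = ∑ G ∈ (edges H V).powerset, (-1 : ℤ) ^ G.card :=
        Finset.sum_fiberwise_of_maps_to (fun G _ => components_mem_setPartitions G V) _
    _ = edgeFreeInd H V := by
        rw [Finset.sum_powerset_neg_one_pow_card, edgeFreeInd]
        exact if_congr (edges_eq_empty_iff hsymm) rfl rfl

/-! ## §6 The Möbius-defined Ursell coefficient IS the connected-graph sum -/

/-- **`hcUrsell H V = Σ_{G connected spanning on V, G ⊆ H} (−1)^{|G|}`** for symmetric `H` and nonempty `V`: both satisfy the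
defining identity (sunset), which determines them (strong induction on `V`, splitting off the one-block partition). [cite: Dimock2013, App. B Theorem cluster, proof step 3 (arXiv:1108.1335v2 TeX L3316–3354)] -/
theorem hcUrsell_eq_connSum (hsymm : ∀ a b, H a b → H b a) : ∀ (V : Finset α), V.Nonempty → hcUrsell H V = connSum H V := by
  intro V
  induction V using Finset.strongInduction with
  | H V ih =>
    intro hV
    have hmem : {V} ∈ setPartitions V := mem_setPartitions.2 (isSetPartition_singleton hV)
    have key := sum_setPartitions_prod_connSum hsymm V
    rw [← Finset.add_sum_erase _ _ hmem, Finset.prod_singleton] at key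
    rw [hcUrsell_eq, ← key, add_sub_assoc, add_eq_left, sub_eq_zero]
    refine Finset.sum_congr rfl fun π hπ => Finset.prod_congr rfl fun P hP => ?_
    obtain ⟨hne, hπ'⟩ := Finset.mem_erase.1 hπ
    have hπs := mem_setPartitions.1 hπ'
    have hPV : P ⊂ V := Finset.ssubset_iff_subset_ne.2 ⟨hπs.subset hP, fun h => hne (by
      subst h; exact hπs.eq_singleton_of_mem hP)⟩
    exact (ih P hPV (hπs.nonempty_of_mem hP)).symm

/-! ## §7 The print's form: the sum over ALL connected graphs on the index set with the weights `Π (ζ − 1)` -/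

variable (H)

/-- all pairs of distinct elements of `I` (the edges of the complete graph on `I`). [cite: Dimock2013, App. B Theorem cluster, proof step 3 (arXiv:1108.1335v2 TeX L3316–3354)] -/
def pairs (I : Finset α) : Finset (Sym2 α) := edges (fun _ _ => True) I

/-- the hard-core edge weight `ζ − 1 ∈ {0, −1}` of a pair: `−1` on the edges of `H` (*"ζ(X,Y) = 0 if X ∩ Y ≠ ∅"*), `0` on the
other pairs (*"ζ(X,Y) = 1 if X ∩ Y = ∅"*). [cite: Dimock2013, App. B Theorem cluster, proof step 3 (arXiv:1108.1335v2 TeX L3316–3354)] -/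
def zetaSubOne (I : Finset α) (e : Sym2 α) : ℤ := if e ∈ edges H I then -1 else 0

variable {H}

/-- the edges of `H` are pairs. [cite: Dimock2013, App. B Theorem cluster, proof step 3 (arXiv:1108.1335v2 TeX L3316–3354)] -/
theorem edges_subset_pairs (I : Finset α) : edges H I ⊆ pairs I := by
  intro e he
  simp only [pairs, edges, Finset.mem_image, Finset.mem_filter, Finset.mem_product, Prod.exists, and_true] at he ⊢
  obtain ⟨a, b, ⟨⟨ha, hb⟩, hne, -⟩, rfl⟩ := he
  exact ⟨a, b, ⟨⟨ha, hb⟩, hne⟩, rfl⟩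

open Classical in
/-- **THE PRINTED DEFINITION**: `connSum H I = Σ_{G connected graph on I} Π_{{i,j} ∈ G} (ζ_{ij} − 1)` — the sum over ALL connected
spanning graphs on the index set with the hard-core weights; the graphs not contained in `H` contribute `0`. [cite: Dimock2013, App. B Theorem cluster, proof step 3 (arXiv:1108.1335v2 TeX L3316–3354)] -/
theorem connSum_eq_sum_graphs (I : Finset α) :
    connSum H I = ∑ G ∈ (pairs I).powerset with IsConnColl (Adj G) I, ∏ e ∈ G, zetaSubOne H I e := by
  classical
  unfold connSum
  have hsub : connSets H I ⊆ (pairs I).powerset.filter fun G => IsConnColl (Adj G) I := by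
    intro G hG
    obtain ⟨hGE, hconn⟩ := mem_connSets.1 hG
    exact Finset.mem_filter.2 ⟨Finset.mem_powerset.2 (hGE.trans (edges_subset_pairs I)), hconn⟩
  rw [← Finset.sum_subset hsub]
  · refine Finset.sum_congr rfl fun G hG => ?_
    obtain ⟨hGE, -⟩ := mem_connSets.1 hG
    have h1 : ∀ e ∈ G, zetaSubOne H I e = -1 := fun e he => by simp [zetaSubOne, hGE he]
    rw [Finset.prod_congr rfl h1, Finset.prod_const]
  · intro G hG hGn
    obtain ⟨-, hconn⟩ := Finset.mem_filter.1 hG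
    have : ¬ G ⊆ edges H I := fun h => hGn (mem_connSets.2 ⟨h, hconn⟩)
    obtain ⟨e, heG, he⟩ := Finset.not_subset.1 this
    exact Finset.prod_eq_zero heG (by simp [zetaSubOne, he])

open Classical in
/-- **`ρ^T` AS PRINTED = the Möbius-defined coefficient**: for symmetric `H` and nonempty `I`,
`hcUrsell H I = Σ_{G connected graph on I} Π_{{i,j}∈G} (ζ_{ij} − 1)`. [cite: Dimock2013, App. B Theorem cluster, proof step 3 (arXiv:1108.1335v2 TeX L3316–3354)] -/
theorem hcUrsell_eq_sum_graphs (hsymm : ∀ a b, H a b → H b a) {I : Finset α} (hI : I.Nonempty) :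
    hcUrsell H I = ∑ G ∈ (pairs I).powerset with IsConnColl (Adj G) I, ∏ e ∈ G, zetaSubOne H I e := by
  rw [hcUrsell_eq_connSum hsymm I hI, connSum_eq_sum_graphs]

open Classical in
/-- **DIMOCK'S `ρ^T(Y_1,…,Y_n)`** for a tuple of cube sets `Y : ι → Finset C` (the overlap graph `g`: `{i,j} ∈ g` iff
`Y_i ∩ Y_j ≠ ∅`; this relation is `UrsellTreeGraphBound.overlapGraph Y` and `hcUrsell` of it is `UrsellTreeGraphBound.rhoT Y I`,
both by `rfl` — that sibling leaf is not imported): the unique solution of (sunset) equals the printed connected-graph sum. [cite: Dimock2013, App. B Theorem cluster, proof step 3 (arXiv:1108.1335v2 TeX L3316–3354)] -/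
theorem hcUrsell_overlap_eq_sum_graphs {ι : Type*} [DecidableEq ι] {C : Type*} [DecidableEq C] (Y : ι → Finset C)
    {I : Finset ι} (hI : I.Nonempty) :
    hcUrsell (fun i j => ¬ Disjoint (Y i) (Y j)) I =
      ∑ G ∈ (pairs I).powerset with IsConnColl (Adj G) I, ∏ e ∈ G, zetaSubOne (fun i j => ¬ Disjoint (Y i) (Y j)) I e :=
  hcUrsell_eq_sum_graphs (fun _ _ h h' => h h'.symm) hI

end Literature.MathematicalPhysics.QuantumFieldTheory.Dimock2011to13.UrsellConnectedGraphSum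

end
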